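import Summits.BirchSwinnertonDyer.Rank1Residual.P2.ShuZhaiThirtySixSlices
import Summits.BirchSwinnertonDyer.Rank1Residual.WAll.TargetCMTwoSlices
import Literature.NumberTheory.EllipticCurves.NoEverywhereGoodReductionRat
import Literature.NumberTheory.EllipticCurves.Rank1Residual.X11RankOneCertificates.Minimality
import HarnessLib

/-!
# Cell `bsd-print-cf2` (D-0131 (2) PRINT TIER, leaf CornerF @ `p = 2`), prover p3 — file 4: the
# Shu–Zhai twists of `36a1` are BAD (additive) at `2`, so the family lies in the slice
# `WAllCornerFTwoInertBad` (`2` inert in `K`, bad at `2`) of `WAll/TargetCMTwoSlices.lean` — IN THE KERNEL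

HONEST FRAMING. Companion of `P2/ShuZhaiThirtySixCurve.lean`, `P2/ShuZhaiThirtySixAdmissible.lean`,
`P2/ShuZhaiThirtySixSlices.lean` (the BY-NAME slice of the W-ALL leaf
`Summit.BirchSwinnertonDyer.WAllCornerFTwo` given by Shu–Zhai 2021 Thm 1.2 / 1.4 at `E = 36a1`; HONEST
FRAMING there). The leaf is OPEN AS A CLASS; nothing class-wide is closed; no named fact, nothing
asserted. This file only PLACES the family on the partition: the explicit twist
`E^{(−m)} : y² = x³ + 3m x² + 3m² x` (`m = p·∏q` odd, square-free, prime to `3`) is a globally minimal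
integer model (Silverman VII.1.1: `Δ = −2⁴·3³·m⁶`, `q¹² ∤ Δ` at every prime), `2 ∣ Δ_min`, hence every
`ℚ`-model of it has BAD reduction at `2` (good reduction is model-independent, tree
`hasGoodReductionAtPrime_iff_of_variableChange`; `p ∣ Δ_min ⇒` bad, tree
`not_hasGoodReductionAtPrime_of_dvd_minimalDiscriminantInt`); with `CMInert W 2` (file 3) the family is
inside seat p4's slice `WAllCornerFTwoInertBad` (`WAll/TargetCMTwoSlices.lean`, p532371) — the part of
the sub-lane target `P2.CMNonsplitRankOneAtTwo` that is additive at `2`.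

References: [ShuZhai2021] Thm 1.2 / 1.4, §5.2 Table row 36a1; [SilvermanAEC2009] VII.1 Rem 1.1, VII.5
Prop 5.1(a); tree files cited inline.
-/

noncomputable section

open scoped Classical

open WeierstrassCurve NumberField Literature.NumberTheory.EllipticCurves
  Literature.NumberTheory.EllipticCurves.Rank1Residual
  Literature.NumberTheory.EllipticCurves.ModularForms
  Literature.NumberTheory.EllipticCurves.ShuZhai2021
  Literature.NumberTheory.EllipticCurves.Rank1Residual.X11RankOneCertificates
  Summit.BirchSwinnertonDyer.Rank1Residual

set_option autoImplicit false

namespace Summit.BirchSwinnertonDyer.Rank1Residual.P2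

/-! ## §1 The explicit twist model and its global minimality -/

/-- **The twist `E^{(−m)}` of `E = curve36a1` is `y² = x³ + 3m x² + 3m² x`** (`b₂(E) = −12`,
`b₄(E) = 6`, `b₆(E) = 0`). [cite: SilvermanAEC2009, X.5 Cor. 5.4] -/
theorem quadraticTwist_curve36a1_neg (m : ℕ) :
    curve36a1.quadraticTwist (-(m : ℚ)) =
      (⟨((0 : ℤ) : ℚ), ((3 * m : ℤ) : ℚ), ((0 : ℤ) : ℚ), ((3 * m ^ 2 : ℤ) : ℚ), ((0 : ℤ) : ℚ)⟩ :
        WeierstrassCurve ℚ) := by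
  ext <;> simp [WeierstrassCurve.quadraticTwist, curve36a1, WeierstrassCurve.b₂, WeierstrassCurve.b₄,
    WeierstrassCurve.b₆] <;> ring

/-- `Δ(E^{(−m)}) = −432·m⁶` in the tree's integer recheck `discOf`. [folklore] -/
theorem discOf_twist36 (m : ℕ) :
    discOf [0, 3 * (m : ℤ), 0, 3 * (m : ℤ) ^ 2, 0] = -432 * (m : ℤ) ^ 6 := by
  simp only [discOf, invariants]
  ring

/-- A product of DISTINCT primes is squarefree (local copy of the file-2 lemma). [folklore] -/
private theorem squarefree_prod_primes' {Q : Finset ℕ} (hQ : ∀ q ∈ Q, q.Prime) : Squarefree (∏ q ∈ Q, q) := by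
  classical
  induction Q using Finset.induction_on with
  | empty => simp
  | insert a s ha ih =>
    rw [Finset.prod_insert ha]
    have hap : a.Prime := hQ a (Finset.mem_insert_self a s)
    have hs : ∀ q ∈ s, q.Prime := fun q hq => hQ q (Finset.mem_insert_of_mem hq)
    refine (Nat.squarefree_mul ?_).mpr ⟨hap.squarefree, ih hs⟩
    refine (Nat.Coprime.prod_right fun q hq => (Nat.coprime_primes hap (hs q hq)).mpr ?_)
    rintro rfl
    exact ha hq

/-- **Silverman's criterion for `E^{(−m)}`**: for `m` square-free, odd and prime to `3`, no prime `ℓ` has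
`ℓ¹² ∣ Δ = −2⁴·3³·m⁶` (`ord_ℓ Δ ∈ {4, 3, 6, 0}`). [cite: SilvermanAEC2009, VII.1 Remark 1.1] -/
theorem not_pow_twelve_dvd_disc_twist36 {m : ℕ} (hsq : Squarefree m) (hodd : ¬ 2 ∣ m) (h3 : ¬ 3 ∣ m)
    {ℓ : ℕ} (hℓ : ℓ.Prime) : ¬ (ℓ : ℤ) ^ 12 ∣ discOf [0, 3 * (m : ℤ), 0, 3 * (m : ℤ) ^ 2, 0] := by
  rw [discOf_twist36]
  intro h
  have h' : ℓ ^ 12 ∣ 432 * m ^ 6 := by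
    rw [← Int.natCast_dvd_natCast]; push_cast
    exact (dvd_neg.mpr h).trans (by ring_nf; exact dvd_rfl)
  by_cases hm : ℓ ∣ m
  · -- `ℓ ≥ 5` is prime to `432 = 2⁴·3³`, so `ℓ¹² ∣ m⁶`, `ℓ² ∣ m`: not square-free
    have hℓ2 : ℓ ≠ 2 := by rintro rfl; exact hodd hm
    have hℓ3 : ℓ ≠ 3 := by rintro rfl; exact h3 hm
    have hcop : Nat.Coprime (ℓ ^ 12) (2 ^ 4 * 3 ^ 3) :=
      (Nat.Coprime.mul_right (((Nat.coprime_primes hℓ Nat.prime_two).mpr hℓ2).pow_right 4)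
        (((Nat.coprime_primes hℓ Nat.prime_three).mpr hℓ3).pow_right 3)).pow_left 12
    have h6 : ℓ ^ 12 ∣ m ^ 6 := hcop.dvd_of_dvd_mul_left (by norm_num at h' ⊢; exact h')
    have hsq' : ℓ ^ 2 ∣ m := by
      rw [show ℓ ^ 12 = (ℓ ^ 2) ^ 6 by ring] at h6
      exact (Nat.pow_dvd_pow_iff (by norm_num)).mp h6
    have hu : IsUnit ℓ := hsq ℓ (by rw [← sq]; exact hsq')
    exact hℓ.one_lt.ne' (Nat.isUnit_iff.mp hu)
  · -- `ℓ ∤ m`: `ℓ¹² ∣ 432`, impossible (`ℓ¹² ≥ 4096`)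
    have hcop : Nat.Coprime (ℓ ^ 12) (m ^ 6) :=
      Nat.Coprime.pow 12 6 ((Nat.Prime.coprime_iff_not_dvd hℓ).mpr hm)
    have h432 : ℓ ^ 12 ∣ 432 := hcop.dvd_of_dvd_mul_right h'
    have hle : ℓ ^ 12 ≤ 432 := Nat.le_of_dvd (by norm_num) h432
    have hge : 2 ^ 12 ≤ ℓ ^ 12 := Nat.pow_le_pow_left hℓ.two_le 12
    omega

/-- **`E^{(−m)}` is a globally minimal integer model** for `m` square-free, odd, prime to `3`.
[cite: SilvermanAEC2009, VII.1 Remark 1.1 and VIII.8] -/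
theorem isGloballyMinimal_twist36 {m : ℕ} (hsq : Squarefree m) (hodd : ¬ 2 ∣ m) (h3 : ¬ 3 ∣ m) :
    (curve36a1.quadraticTwist (-(m : ℚ))).IsGloballyMinimal := by
  rw [quadraticTwist_curve36a1_neg]
  have h := isGloballyMinimal_of_int_criterion 0 (3 * m) 0 (3 * m ^ 2) 0 (fun ℓ hℓ hand =>
    not_pow_twelve_dvd_disc_twist36 hsq hodd h3 hℓ (by exact_mod_cast hand.1))
  exact_mod_cast h

/-! ## §2 Bad reduction at `2` for every model of the twist -/

/-- **`2 ∣ Δ_min(E^{(−m)})`** (`Δ_min = Δ = −432·m⁶` on the globally minimal model). [folklore] -/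
theorem two_dvd_minimalDiscriminantInt_twist36 {m : ℕ} (hm0 : m ≠ 0) (hsq : Squarefree m)
    (hodd : ¬ 2 ∣ m) (h3 : ¬ 3 ∣ m) :
    haveI := isGloballyMinimal_twist36 hsq hodd h3
    (2 : ℤ) ∣ minimalDiscriminantInt (curve36a1.quadraticTwist (-(m : ℚ))) := by
  haveI := isGloballyMinimal_twist36 hsq hodd h3
  have hd : (-(m : ℚ)) ≠ 0 := neg_ne_zero.mpr (by exact_mod_cast hm0)
  have hΔ : (curve36a1.quadraticTwist (-(m : ℚ))).Δ = ((-432 * (m : ℤ) ^ 6 : ℤ) : ℚ) := by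
    rw [quadraticTwist_Δ, curve36a1_Δ]; push_cast; ring
  have hmin : minimalDiscriminantInt (curve36a1.quadraticTwist (-(m : ℚ))) = -432 * (m : ℤ) ^ 6 := by
    have h := cast_minimalDiscriminantInt (curve36a1.quadraticTwist (-(m : ℚ)))
    rw [hΔ] at h
    exact_mod_cast h
  rw [hmin]
  exact ⟨-216 * (m : ℤ) ^ 6, by ring⟩

/-- **Every `ℚ`-model `W` of `E^{(−m)}` (`m` square-free, odd, prime to `3`) has BAD reduction at `2`**
(`¬ Good W 2`): good reduction is model-independent and `2 ∣ Δ_min`. In particular the Shu–Zhai twists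
of `36a1` are additive-or-multiplicative (in fact additive, potentially good: `j = 0`) at `2`.
[cite: SilvermanAEC2009, VII.5 Prop. 5.1(a) and VII.1 Prop. 1.3(b)] -/
theorem not_good_two_of_smul_twist36 {m : ℕ} (hm0 : m ≠ 0) (hsq : Squarefree m) (hodd : ¬ 2 ∣ m)
    (h3 : ¬ 3 ∣ m) {W : WeierstrassCurve ℚ} {C : VariableChange ℚ}
    (hC : C • curve36a1.quadraticTwist (-(m : ℚ)) = W) : ¬ Good W 2 := by
  haveI := isGloballyMinimal_twist36 hsq hodd h3
  subst hC
  rw [Good, WeierstrassCurve.hasGoodReductionAtPrime_iff_of_variableChange]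
  exact WeierstrassCurve.not_hasGoodReductionAtPrime_of_dvd_minimalDiscriminantInt _ 2
    (two_dvd_minimalDiscriminantInt_twist36 hm0 hsq hodd h3)

/-! ## §3 Placement: the explicit Shu–Zhai family of `36a1` lies in `WAllCornerFTwoInertBad` -/

/-- `m = p·∏_{q∈Q} q` is square-free, odd and prime to `3` for `p ≡ 23 (mod 24)` prime and `Q` a finite
set of primes `≡ 5 (mod 12)` (`p ∉ Q` as `p ≡ 11 (mod 12)`). [folklore] -/
theorem squarefree_odd_coprime_three_of_family {p : ℕ} (hp : p.Prime) (h24 : p % 24 = 23)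
    {Q : Finset ℕ} (hQ : ∀ q ∈ Q, q.Prime ∧ q % 12 = 5) :
    Squarefree (p * ∏ q ∈ Q, q) ∧ ¬ 2 ∣ p * ∏ q ∈ Q, q ∧ ¬ 3 ∣ p * ∏ q ∈ Q, q := by
  classical
  have hpQ : p ∉ Q := fun h => by have := (hQ p h).2; omega
  have hprod : p * ∏ q ∈ Q, q = ∏ q ∈ insert p Q, q := by rw [Finset.prod_insert hpQ]
  have hall : ∀ q ∈ insert p Q, q.Prime := by
    intro q hq
    rcases Finset.mem_insert.mp hq with rfl | hq
    · exact hp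
    · exact (hQ q hq).1
  refine ⟨hprod ▸ squarefree_prod_primes' hall, ?_, ?_⟩
  · rw [hprod]
    intro h2
    obtain ⟨q, hq, h2q⟩ := (Prime.dvd_finsetProd_iff Nat.prime_two.prime _).mp h2
    have hqp := hall q hq
    have : q = 2 := ((Nat.prime_dvd_prime_iff_eq Nat.prime_two hqp).mp h2q).symm
    rcases Finset.mem_insert.mp hq with rfl | hq'
    · omega
    · have := (hQ q hq').2; omega
  · rw [hprod]
    intro h3
    obtain ⟨q, hq, h3q⟩ := (Prime.dvd_finsetProd_iff Nat.prime_three.prime _).mp h3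
    have hqp := hall q hq
    have : q = 3 := ((Nat.prime_dvd_prime_iff_eq Nat.prime_three hqp).mp h3q).symm
    rcases Finset.mem_insert.mp hq with rfl | hq'
    · omega
    · have := (hQ q hq').2; omega

/-- **PLACEMENT.** Every globally minimal model `W` of an explicit Shu–Zhai twist `36a1^{(−p∏q)}`
(`p ≡ 23 (mod 24)` prime, `Q` primes `≡ 5 (mod 12)`) satisfies `CMInert W 2 ∧ ¬ Good W 2`: the family lies
in seat p4's slice `WAllCornerFTwoInertBad` of the leaf `WAllCornerFTwo` (and in `CornerF♯` at `2`).
With `∏ q ≡ 1 (mod 24)`, granted the facts and the two display hypotheses, `BSD(W, 2)` is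
`cornerFTwo_shuZhaiThirtySix_explicit` (file 3). [cite: ShuZhai2021, Thm. 1.2 / 1.4, §5.2 Table row 36a1] -/
theorem cmInert_and_not_good_two_of_twist_curve36a1 {p : ℕ} (hp : p.Prime) (h24 : p % 24 = 23)
    {Q : Finset ℕ} (hQ : ∀ q ∈ Q, q.Prime ∧ q % 12 = 5)
    {W : WeierstrassCurve ℚ} [W.IsElliptic] [W.IsGloballyMinimal] {C : VariableChange ℚ}
    (hC : C • curve36a1.quadraticTwist (-((p * ∏ q ∈ Q, q : ℕ) : ℚ)) = W) :
    CMInert W 2 ∧ ¬ Good W 2 := by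
  obtain ⟨hsq, hodd, h3⟩ := squarefree_odd_coprime_three_of_family hp h24 hQ
  have hm0 : p * ∏ q ∈ Q, q ≠ 0 :=
    Nat.pos_iff_ne_zero.mp (Nat.mul_pos hp.pos (Finset.prod_pos fun q hq => (hQ q hq).1.pos))
  have hd : (-((p * ∏ q ∈ Q, q : ℕ) : ℚ)) ≠ 0 := neg_ne_zero.mpr (by exact_mod_cast hm0)
  exact ⟨cmInert_two_of_smul_twist_curve36a1 hd hC, not_good_two_of_smul_twist36 hm0 hsq hodd h3 hC⟩

/-- **The slice restated in the InertBad vocabulary**: on the explicit family, the hypotheses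
`CMInert W 2`, `¬ Good W 2` of `WAllCornerFTwoInertBad` HOLD (previous theorem) and the conclusion
`BSDp W 2` holds granted the facts and the display hypotheses — i.e. the family is a closed
sub-family of that open slice. [cite: ShuZhai2021, Thm. 1.2 / 1.4, §5.2 Table row 36a1] -/
theorem wAllCornerFTwoInertBad_on_shuZhaiThirtySix (h12 : thm12_ranks_of_twists)
    (h14 : thm14_twoPartBSD_of_twists) (hCM : bsdTriple_of_hasCM_of_L_one_ne_zero)
    (hmod : hasEntireLFunction_rat)
    (Dt : ModularParametrizationData curve36a1 (curve36a1.conductorNorm ℤ))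
    (hopt : IsOptimalDatum curve36a1 Dt) (hcusp : CuspZeroNotInTwice curve36a1 Dt)
    (hARS : AgasheRibetStein2006.cremona_abs_maninConstant_eq_one_of_level_le) :
    ∀ (W : WeierstrassCurve ℚ) [W.IsElliptic] [W.IsGloballyMinimal],
      ∀ (p : ℕ), p.Prime → p % 24 = 23 →
      ∀ (Q : Finset ℕ), (∀ q ∈ Q, q.Prime ∧ q % 12 = 5) → (∏ q ∈ Q, q) % 24 = 1 →
        ∀ (C : VariableChange ℚ),
          C • curve36a1.quadraticTwist (-((p * ∏ q ∈ Q, q : ℕ) : ℚ)) = W →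
          W.HasCM ∧ W.analyticRank = 1 ∧ CMInert W 2 ∧ ¬ Good W 2 ∧ BSDp W 2 := by
  intro W _ _ p hp h24 Q hQ hM C hC
  obtain ⟨hin, hbad⟩ := cmInert_and_not_good_two_of_twist_curve36a1 hp h24 hQ hC
  obtain ⟨hr, hbsd⟩ := analyticRank_eq_one_and_bsdp_two_of_twist_curve36a1_explicit h12 h14 hCM hmod Dt
    hopt hcusp (not_two_dvd_c_of_isOptimalDatum_curve36a1 hARS Dt hopt) hp h24 hQ hM W ⟨C, hC⟩
  have hm0 : p * ∏ q ∈ Q, q ≠ 0 :=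
    Nat.pos_iff_ne_zero.mp (Nat.mul_pos hp.pos (Finset.prod_pos fun q hq => (hQ q hq).1.pos))
  have hd : (-((p * ∏ q ∈ Q, q : ℕ) : ℚ)) ≠ 0 := neg_ne_zero.mpr (by exact_mod_cast hm0)
  exact ⟨hasCM_of_smul_twist_curve36a1 hd hC, hr, hin, hbad, hbsd⟩

end Summit.BirchSwinnertonDyer.Rank1Residual.P2

end
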